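import Mathlib.Analysis.SpecialFunctions.Integrals.LogTrigonometric
import Mathlib.Analysis.SpecialFunctions.Trigonometric.ArctanDeriv
import Mathlib.MeasureTheory.Function.JacobianOneDim
import Mathlib.Analysis.SpecialFunctions.Integrals.Basic
import Mathlib.MeasureTheory.Integral.IntegralEqImproper
import Mathlib.Analysis.Complex.ExponentialBounds
import Mathlib.Analysis.Real.Pi.Bounds
import HarnessLib

/-!
# `∫ log(1 + x²)/(1 + x²) dx = 2π log 2` and companions

Topic `Literature/Analysis/SpecialFunctions`. Everything in this file is PROVED; no named fact and no
definition is introduced.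

The classical evaluation `∫_{−∞}^{∞} log(1 + x²)/(1 + x²) dx = 2π log 2` (substitute `x = tan θ`:
the integrand becomes `−2 log cos θ` on `(−π/2, π/2)`, and `∫_0^{π/2} log sin = −(π/2) log 2` is
Mathlib's `integral_log_sin_zero_pi_div_two`), together with `∫ x²/(1 + x²)² dx = π/2` (the same
substitution gives `sin²θ`) and the consequence
`∫ log(1 + x²/4)/(1 + x²) dx ≤ 2π log 2 − 3π/8` (from `log(1 − ¾ y) ≤ −¾ y`, `y = x²/(1 + x²)`;
the exact value is `2π log(3/2)`). These are the numerical inputs of the error term of K. Ford's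
smoothed explicit formula (*Zero-free regions for the Riemann zeta function*, 2002, proof of
Lemma 4.5: `∫ log(1+v²)/(1+v²) dv`, evaluated there implicitly), see
`Literature/NumberTheory/LFunctions/` (Ford's Lemma 4.5).

* `integral_comp_tan`, `integrable_iff_comp_tan` — the substitution `x = tan θ` on the whole line
  (Mathlib's change of variables `integral_image_eq_integral_abs_deriv_smul` with `tan` injective on
  `(−π/2, π/2)` onto `ℝ`);
* `integral_log_cos_neg_pi_div_two_pi_div_two` — `∫_{−π/2}^{π/2} log cos = −π log 2`;
* `integral_log_one_add_sq_div` (`= 2π log 2`), `integral_sq_div_one_add_sq_sq` (`= π/2`),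
  `integral_log_one_add_sq_div_four_le` (`≤ 2π log 2 − 3π/8`), and the integrability of the three
  integrands.

## References

* I. S. Gradshteyn, I. M. Ryzhik, *Table of Integrals, Series, and Products*, 4.295.7 (`a = b = 1`)
  and 4.224.3 (`∫_0^{π/2} log sin`). [folklore]
* K. Ford, *Zero-free regions for the Riemann zeta function*, Number Theory for the Millennium II,
  A K Peters 2002, proof of Lemma 4.5. [Ford2002Millennium]
-/

noncomputable section

open Real Set MeasureTheory intervalIntegral

namespace Literature.Analysis.SpecialFunctions

/-! ### The substitution `x = tan θ` on the whole line -/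

/-- `tan` maps `(−π/2, π/2)` onto `ℝ`. [folklore] -/
theorem image_tan_Ioo : Real.tan '' Ioo (-(π / 2)) (π / 2) = univ :=
  eq_univ_of_forall fun x ↦ Real.surjOn_tan (mem_univ x)

/-- **Substitution `x = tan θ`**: for any `g`,
`∫_{−∞}^{∞} g(x) dx = ∫_{(−π/2, π/2)} g(tan θ)/cos²θ dθ` (both sides `0` if not integrable).
[folklore] -/
theorem integral_comp_tan (g : ℝ → ℝ) :
    ∫ x : ℝ, g x = ∫ θ in Ioo (-(π / 2)) (π / 2), 1 / Real.cos θ ^ 2 * g (Real.tan θ) := by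
  have h := integral_image_eq_integral_abs_deriv_smul (s := Ioo (-(π / 2)) (π / 2)) (f := Real.tan)
    (f' := fun θ ↦ 1 / Real.cos θ ^ 2) measurableSet_Ioo
    (fun θ hθ ↦ (Real.hasDerivAt_tan (cos_pos_of_mem_Ioo hθ).ne').hasDerivWithinAt) Real.injOn_tan g
  rw [image_tan_Ioo, setIntegral_univ] at h
  rw [h]
  refine setIntegral_congr_fun measurableSet_Ioo fun θ hθ ↦ ?_
  rw [smul_eq_mul, abs_of_pos (by have := cos_pos_of_mem_Ioo hθ; positivity)]

/-- The same substitution for integrability. [folklore] -/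
theorem integrable_iff_comp_tan (g : ℝ → ℝ) :
    Integrable g ↔ IntegrableOn (fun θ ↦ 1 / Real.cos θ ^ 2 * g (Real.tan θ)) (Ioo (-(π / 2)) (π / 2)) := by
  have h := integrableOn_image_iff_integrableOn_abs_deriv_smul (s := Ioo (-(π / 2)) (π / 2)) (f := Real.tan)
    (f' := fun θ ↦ 1 / Real.cos θ ^ 2) measurableSet_Ioo
    (fun θ hθ ↦ (Real.hasDerivAt_tan (cos_pos_of_mem_Ioo hθ).ne').hasDerivWithinAt) Real.injOn_tan g
  rw [image_tan_Ioo, integrableOn_univ] at h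
  rw [h]
  refine integrableOn_congr_fun (fun θ hθ ↦ ?_) measurableSet_Ioo
  rw [smul_eq_mul, abs_of_pos (by have := cos_pos_of_mem_Ioo hθ; positivity)]

/-- On `(−π/2, π/2)`: `1 + tan²θ = 1/cos²θ`. [folklore] -/
theorem one_add_tan_sq {θ : ℝ} (hθ : θ ∈ Ioo (-(π / 2)) (π / 2)) :
    1 + Real.tan θ ^ 2 = 1 / Real.cos θ ^ 2 := by
  have hc := (cos_pos_of_mem_Ioo hθ).ne'
  rw [← Real.inv_one_add_tan_sq hc, one_div, inv_inv]

/-! ### `∫_{−π/2}^{π/2} log cos θ dθ = −π log 2` -/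

/-- `∫_{−π/2}^{π/2} log(cos θ) dθ = −π log 2` (Mathlib's `∫_0^{π/2} log sin = −(π/2) log 2`, the
symmetry of `cos`, and `cos θ = sin(π/2 − θ)`). [folklore] -/
theorem integral_log_cos_neg_pi_div_two_pi_div_two :
    ∫ θ in (-(π / 2))..(π / 2), Real.log (Real.cos θ) = -π * Real.log 2 := by
  have h1 : ∫ θ in (-(π / 2))..0, Real.log (Real.cos θ) = ∫ θ in (0:ℝ)..(π / 2), Real.log (Real.cos θ) := by
    have := intervalIntegral.integral_comp_neg (a := -(π / 2)) (b := 0) (fun θ ↦ Real.log (Real.cos θ))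
    simp only [Real.cos_neg, neg_neg, neg_zero] at this
    rw [this]
  have h2 : ∫ θ in (0:ℝ)..(π / 2), Real.log (Real.cos θ) = ∫ θ in (0:ℝ)..(π / 2), Real.log (Real.sin θ) := by
    have := intervalIntegral.integral_comp_sub_left (a := 0) (b := π / 2) (fun θ ↦ Real.log (Real.sin θ)) (π / 2)
    simp only [Real.sin_pi_div_two_sub, sub_self, sub_zero] at this
    rw [this]
  have hI : ∀ a b : ℝ, IntervalIntegrable (fun θ ↦ Real.log (Real.cos θ)) volume a b :=
    fun a b ↦ intervalIntegrable_log_cos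
  rw [← intervalIntegral.integral_add_adjacent_intervals (b := 0) (hI _ _) (hI _ _), h1, h2,
    integral_log_sin_zero_pi_div_two]
  ring

/-! ### The three integrals -/

/-- **`∫_{−∞}^{∞} log(1 + x²)/(1 + x²) dx = 2π log 2`** (substitute `x = tan θ`: the integrand
becomes `−2 log cos θ`). [folklore] -/
theorem integral_log_one_add_sq_div : ∫ x : ℝ, Real.log (1 + x ^ 2) / (1 + x ^ 2) = 2 * π * Real.log 2 := by
  rw [integral_comp_tan]
  have hcongr : EqOn (fun θ ↦ 1 / Real.cos θ ^ 2 * (Real.log (1 + Real.tan θ ^ 2) / (1 + Real.tan θ ^ 2)))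
      (fun θ ↦ -2 * Real.log (Real.cos θ)) (Ioo (-(π / 2)) (π / 2)) := by
    intro θ hθ
    have hc := cos_pos_of_mem_Ioo hθ
    simp only
    rw [one_add_tan_sq hθ, one_div, Real.log_inv, Real.log_pow]
    field_simp
    ring
  rw [setIntegral_congr_fun measurableSet_Ioo hcongr, ← integral_Ioc_eq_integral_Ioo,
    ← intervalIntegral.integral_of_le (by linarith [Real.pi_pos]), intervalIntegral.integral_const_mul,
    integral_log_cos_neg_pi_div_two_pi_div_two]
  ring

/-- `x ↦ log(1 + x²)/(1 + x²)` is integrable on `ℝ`. [folklore] -/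
theorem integrable_log_one_add_sq_div : Integrable fun x : ℝ ↦ Real.log (1 + x ^ 2) / (1 + x ^ 2) := by
  rw [integrable_iff_comp_tan]
  have h : IntegrableOn (fun θ ↦ -2 * Real.log (Real.cos θ)) (Ioo (-(π / 2)) (π / 2)) := by
    have hI : IntervalIntegrable (fun θ ↦ Real.log (Real.cos θ)) volume (-(π / 2)) (π / 2) :=
      intervalIntegrable_log_cos
    have := hI.const_mul (-2)
    rw [intervalIntegrable_iff_integrableOn_Ioo_of_le (by linarith [Real.pi_pos])] at this
    exact this
  refine h.congr_fun (fun θ hθ ↦ ?_) measurableSet_Ioo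
  have hc := cos_pos_of_mem_Ioo hθ
  simp only
  rw [one_add_tan_sq hθ, one_div, Real.log_inv, Real.log_pow]
  field_simp
  ring

/-- **`∫_{−∞}^{∞} x²/(1 + x²)² dx = π/2`** (substitute `x = tan θ`: the integrand becomes `sin²θ`).
[folklore] -/
theorem integral_sq_div_one_add_sq_sq : ∫ x : ℝ, x ^ 2 / (1 + x ^ 2) ^ 2 = π / 2 := by
  rw [integral_comp_tan]
  have hcongr : EqOn (fun θ ↦ 1 / Real.cos θ ^ 2 * (Real.tan θ ^ 2 / (1 + Real.tan θ ^ 2) ^ 2))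
      (fun θ ↦ Real.sin θ ^ 2) (Ioo (-(π / 2)) (π / 2)) := by
    intro θ hθ
    have hc := cos_pos_of_mem_Ioo hθ
    simp only
    rw [one_add_tan_sq hθ, Real.tan_eq_sin_div_cos]
    field_simp
  rw [setIntegral_congr_fun measurableSet_Ioo hcongr, ← integral_Ioc_eq_integral_Ioo,
    ← intervalIntegral.integral_of_le (by linarith [Real.pi_pos]), integral_sin_sq]
  simp

/-- `x ↦ x²/(1 + x²)²` is integrable on `ℝ`. [folklore] -/
theorem integrable_sq_div_one_add_sq_sq : Integrable fun x : ℝ ↦ x ^ 2 / (1 + x ^ 2) ^ 2 := by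
  rw [integrable_iff_comp_tan]
  have h : IntegrableOn (fun θ ↦ Real.sin θ ^ 2) (Ioo (-(π / 2)) (π / 2)) :=
    ((by fun_prop : Continuous fun θ ↦ Real.sin θ ^ 2).integrableOn_Icc).mono_set Ioo_subset_Icc_self
  refine h.congr_fun (fun θ hθ ↦ ?_) measurableSet_Ioo
  have hc := cos_pos_of_mem_Ioo hθ
  simp only
  rw [one_add_tan_sq hθ, Real.tan_eq_sin_div_cos]
  field_simp

/-- Pointwise: `log(1 + x²/4) ≤ log(1 + x²) − (3/4) x²/(1 + x²)`
(`log(1 − ¾·x²/(1+x²)) ≤ −¾·x²/(1+x²)`). [folklore] -/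
theorem log_one_add_sq_div_four_le (x : ℝ) :
    Real.log (1 + x ^ 2 / 4) ≤ Real.log (1 + x ^ 2) - 3 / 4 * (x ^ 2 / (1 + x ^ 2)) := by
  have h1 : 0 < 1 + x ^ 2 := by positivity
  have h2 : 0 < 1 + x ^ 2 / 4 := by positivity
  have hq : (1 + x ^ 2 / 4) / (1 + x ^ 2) = 1 - 3 / 4 * (x ^ 2 / (1 + x ^ 2)) := by
    field_simp; ring
  have h3 : Real.log ((1 + x ^ 2 / 4) / (1 + x ^ 2)) ≤ (1 + x ^ 2 / 4) / (1 + x ^ 2) - 1 :=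
    Real.log_le_sub_one_of_pos (by positivity)
  rw [Real.log_div h2.ne' h1.ne'] at h3
  rw [hq] at h3
  linarith

/-- **`∫_{−∞}^{∞} log(1 + x²/4)/(1 + x²) dx ≤ 2π log 2 − 3π/8`** (`≈ 3.18`; the exact value is
`2π log(3/2) ≈ 2.55`). [folklore] -/
theorem integral_log_one_add_sq_div_four_le :
    ∫ x : ℝ, Real.log (1 + x ^ 2 / 4) / (1 + x ^ 2) ≤ 2 * π * Real.log 2 - 3 * π / 8 := by
  have hI1 := integrable_log_one_add_sq_div
  have hI2 := integrable_sq_div_one_add_sq_sq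
  have hle : ∀ x : ℝ, Real.log (1 + x ^ 2 / 4) / (1 + x ^ 2) ≤
      Real.log (1 + x ^ 2) / (1 + x ^ 2) - 3 / 4 * (x ^ 2 / (1 + x ^ 2) ^ 2) := by
    intro x
    have h1 : 0 < 1 + x ^ 2 := by positivity
    have h := div_le_div_of_nonneg_right (log_one_add_sq_div_four_le x) h1.le
    rw [sub_div] at h
    refine h.trans (le_of_eq ?_)
    congr 1
    field_simp
  by_cases hint : Integrable fun x : ℝ ↦ Real.log (1 + x ^ 2 / 4) / (1 + x ^ 2)
  · calc ∫ x : ℝ, Real.log (1 + x ^ 2 / 4) / (1 + x ^ 2)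
        ≤ ∫ x : ℝ, (Real.log (1 + x ^ 2) / (1 + x ^ 2) - 3 / 4 * (x ^ 2 / (1 + x ^ 2) ^ 2)) :=
          integral_mono hint (hI1.sub (hI2.const_mul _)) hle
      _ = 2 * π * Real.log 2 - 3 / 4 * (π / 2) := by
          rw [integral_sub hI1 (hI2.const_mul _), MeasureTheory.integral_const_mul, integral_log_one_add_sq_div,
            integral_sq_div_one_add_sq_sq]
      _ = 2 * π * Real.log 2 - 3 * π / 8 := by ring
  · rw [integral_undef hint]
    have h2 := Real.log_two_gt_d9
    nlinarith [Real.pi_gt_three]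

/-- `x ↦ log(1 + x²/4)/(1 + x²)` is integrable on `ℝ` (dominated by `log(1 + x²)/(1 + x²)`).
[folklore] -/
theorem integrable_log_one_add_sq_div_four :
    Integrable fun x : ℝ ↦ Real.log (1 + x ^ 2 / 4) / (1 + x ^ 2) := by
  refine integrable_log_one_add_sq_div.mono ?_ (ae_of_all _ fun x ↦ ?_)
  · have hc : Continuous fun x : ℝ ↦ Real.log (1 + x ^ 2 / 4) / (1 + x ^ 2) :=
      ((Continuous.log (by fun_prop) (fun x ↦ by positivity)).div (by fun_prop) (fun x ↦ by positivity))
    exact hc.aestronglyMeasurable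
  · have h1 : 0 < 1 + x ^ 2 := by positivity
    rw [Real.norm_eq_abs, Real.norm_eq_abs, abs_of_nonneg (div_nonneg (Real.log_nonneg (by nlinarith)) h1.le),
      abs_of_nonneg (div_nonneg (Real.log_nonneg (by nlinarith)) h1.le)]
    exact div_le_div_of_nonneg_right (Real.log_le_log (by positivity) (by nlinarith)) h1.le

end Literature.Analysis.SpecialFunctions
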